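import Literature.Geometry.Lorentzian.KerrTortoiseZones
import Literature.Analysis.ODE.SoninPiecewise
import HarnessLib

/-!
# The horizon-side oscillatory zone of Carter's equation: a-priori bounds for a solution with `𝓗⁺` data
(namespace `Literature.Geometry.Lorentzian.Kerr`.)

Carter's radial equation in the tortoise variable, `u″ + (ω² − V(ρ x)) u = 0`
(`V = Kerr.sepPotential M a ω m Λ`, `ρ` a tortoise radius function; DRSR arXiv:1402.7034, §5.2.3),
has the coefficient `φ = ω² − V ∘ ρ` tending to `σ² := (ω − mω₊)²` at `x → −∞` (DRSR Lemma 6.3.2: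
`ω² − V(r₊) = (ω − mω₊)²`). Quantitatively, `|V(r) − V(r₊)| ≤ (208Λ/M³)(r − r₊)`
(`|dV/dr| ≤ 24Λ/r³ + 184M/r⁴`, `Kerr.abs_deriv_sepPotential_le`), so on the HORIZON ZONE
`ρ x − r₊ ≤ σ²M³/(416Λ)` the coefficient stays in `[σ²/2, 3σ²/2]` and the Sonin energy
`T = φ‖u‖² + ‖u′‖²` of any solution changes by at most the factor `3^8` across it (≤ 8 monotone pieces,
`SoninPiecewise.soninEnergy_le_pow_ratio`). For the solution with the data of the `𝓗⁺`-normalised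
solution (`‖u‖ → 1`, `‖u′‖ → |ω − mω₊|`, so `T → 2σ²`):

* `abs_sepPotential_sub_rPlus_le` — `|V(r) − V(r₊)| ≤ (208Λ/M³)(r − r₊)` (`r ≥ r₊`, `Λ ≥ 1`);
* `coeff_mem_Icc_of_horizonZone` — `σ²/2 ≤ ω² − V(ρ x) ≤ 3σ²/2` on the horizon zone;
* `tendsto_coeff_atBot` — `ω² − V(ρ x) → σ²` as `x → −∞`;
* `carter_horizonZone_energy_le` — `T(y) ≤ 3^9 σ²` on the horizon zone, hence
  `‖u y‖² ≤ 2·3^9` and `‖u′ y‖² ≤ 3^9 σ²` (`carter_horizonZone_norm_sq_le`);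
* `carter_horizonZone_energy_le_of_data` — for ANY solution, `T(y) ≤ 3^8·T(x)` for two points of
  the horizon zone (used for the `𝓘⁺`-solution when there is no barrier).

## References
* M. Dafermos, I. Rodnianski, Y. Shlapentokh-Rothman, arXiv:1402.7034 = Ann. of Math. 183 (2016),
  §5.2.3, Lemma 6.3.2, §8.4 (key `DafermosRodnianskiShlapentokhrothman2014`).
* G. Szegő, *Orthogonal Polynomials*, §7.31 (Sonin–Pólya).
-/

noncomputable section

open Filter Set
open scoped _root_.Topology

namespace Literature.Geometry.Lorentzian

namespace Kerr

/-! ### The potential near the horizon -/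

/-- **`|V(r) − V(r₊)| ≤ (208Λ/M³)(r − r₊)`** for `r ≥ r₊`, `|a| ≤ M`, an admissible triple with `Λ ≥ 1`
(mean value inequality with `|dV/dr| ≤ 24Λ/r³ + 184M/r⁴ ≤ 208Λ/M³` on `r ≥ r₊ ≥ M`).
[cite: DafermosRodnianskiShlapentokhrothman2014, §8.4] -/
theorem abs_sepPotential_sub_rPlus_le {M a ω Λ : ℝ} {m : ℤ} (hM : 0 < M) (haM : |a| ≤ M)
    (hadm : IsAdmissibleTriple a ω m Λ) (hΛ : 1 ≤ Λ) {r : ℝ} (hr : rPlus M a ≤ r) :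
    |sepPotential M a ω m Λ r - sepPotential M a ω m Λ (rPlus M a)| ≤
      208 * Λ / M ^ 3 * (r - rPlus M a) := by
  have hMr : M ≤ rPlus M a := M_le_rPlus M a
  have hbound : ∀ s ∈ Icc (rPlus M a) r, ‖deriv (sepPotential M a ω m Λ) s‖ ≤ 208 * Λ / M ^ 3 := by
    intro s hs
    have hsM : M ≤ s := hMr.trans hs.1
    have hs0 : 0 < s := hM.trans_le hsM
    have h := abs_deriv_sepPotential_le hM haM hadm hs.1
    rw [Real.norm_eq_abs]
    refine h.trans ?_
    have h1 : 24 * Λ / s ^ 3 ≤ 24 * Λ / M ^ 3 := by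
      apply div_le_div_of_nonneg_left (by positivity) (by positivity)
      exact pow_le_pow_left₀ hM.le hsM 3
    have h2 : 184 * M / s ^ 4 ≤ 184 / M ^ 3 := by
      rw [div_le_div_iff₀ (by positivity) (by positivity)]
      have : M ^ 4 ≤ s ^ 4 := pow_le_pow_left₀ hM.le hsM 4
      nlinarith
    have h3 : 24 * Λ / M ^ 3 + 184 / M ^ 3 ≤ 208 * Λ / M ^ 3 := by
      rw [← add_div]
      exact div_le_div_of_nonneg_right (by linarith) (by positivity)
    linarith
  have hdiff : ∀ s ∈ Icc (rPlus M a) r,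
      HasDerivWithinAt (sepPotential M a ω m Λ) (deriv (sepPotential M a ω m Λ) s) (Icc (rPlus M a) r) s := by
    intro s hs
    have hs0 : 0 < s := (hM.trans_le hMr).trans_le hs.1
    have hne : s ^ 2 + a ^ 2 ≠ 0 := by positivity
    exact (hasDerivAt_sepPotential M a ω m Λ hne).differentiableAt.hasDerivAt.hasDerivWithinAt
  have h := norm_image_sub_le_of_norm_deriv_le_segment' hdiff
    (fun s hs ↦ hbound s (Ico_subset_Icc_self hs)) r (right_mem_Icc.2 hr)
  rw [Real.norm_eq_abs] at h
  exact h

/-- **DRSR Lemma 6.3.2 in `ω₊`-form**: `ω² − V(r₊) = (ω − mω₊)²`, `ω₊ = a/(2Mr₊)`.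
[cite: DafermosRodnianskiShlapentokhrothman2014, Lemma 6.3.2] -/
theorem omega_sq_sub_sepPotential_rPlus_eq_sq {M a : ℝ} (haM : |a| ≤ M) (hM : 0 < M) (ω : ℝ) (m : ℤ)
    (Λ : ℝ) :
    ω ^ 2 - sepPotential M a ω m Λ (rPlus M a) = (ω - m * horizonAngularVelocity M a) ^ 2 := by
  rw [omega_sq_sub_sepPotential_rPlus haM hM]
  have hr : 0 < rPlus M a := rPlus_pos hM a
  unfold horizonAngularVelocity
  field_simp
  ring

/-- **The coefficient on the horizon zone**: if `ρ x − r₊ ≤ σ²M³/(416Λ)` with `σ = ω − mω₊` then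
`σ²/2 ≤ ω² − V(ρ x) ≤ 3σ²/2` (`|a| < M`, admissible triple, `Λ ≥ 1`). [folklore] -/
theorem coeff_mem_Icc_of_horizonZone {M a ω Λ : ℝ} {m : ℤ} {ρ : ℝ → ℝ} (hρ : IsTortoiseRadius M a ρ)
    (hMa : IsSubextremal M a) (hadm : IsAdmissibleTriple a ω m Λ) (hΛ : 1 ≤ Λ) {x : ℝ}
    (hx : ρ x - rPlus M a ≤ (ω - m * horizonAngularVelocity M a) ^ 2 * M ^ 3 / (416 * Λ)) :
    (ω - m * horizonAngularVelocity M a) ^ 2 / 2 ≤ ω ^ 2 - sepPotential M a ω m Λ (ρ x) ∧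
      ω ^ 2 - sepPotential M a ω m Λ (ρ x) ≤ 3 * (ω - m * horizonAngularVelocity M a) ^ 2 / 2 := by
  have hM : 0 < M := hMa.pos
  set σ := ω - m * horizonAngularVelocity M a with hσ
  have hV := abs_sepPotential_sub_rPlus_le hM (le_of_lt hMa) hadm hΛ (hρ.rPlus_lt x).le
  have hid := omega_sq_sub_sepPotential_rPlus_eq_sq (le_of_lt hMa) hM ω m Λ
  have h1 : 208 * Λ / M ^ 3 * (ρ x - rPlus M a) ≤ σ ^ 2 / 2 := by
    calc 208 * Λ / M ^ 3 * (ρ x - rPlus M a) ≤ 208 * Λ / M ^ 3 * (σ ^ 2 * M ^ 3 / (416 * Λ)) :=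
          mul_le_mul_of_nonneg_left hx (by positivity)
      _ = σ ^ 2 / 2 := by field_simp; ring
  have h2 := (abs_le.1 (hV.trans h1))
  constructor <;> linarith [h2.1, h2.2]

/-- `ω² − V(ρ x) → (ω − mω₊)²` as `x → −∞` along a tortoise radius (`V` is continuous at `r₊`,
`ρ → r₊`). [cite: DafermosRodnianskiShlapentokhrothman2014, Lemma 6.3.2] -/
theorem IsTortoiseRadius.tendsto_coeff_atBot {M a : ℝ} {ρ : ℝ → ℝ} (hρ : IsTortoiseRadius M a ρ)
    (hMa : IsSubextremal M a) (ω : ℝ) (m : ℤ) (Λ : ℝ) :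
    Tendsto (fun x ↦ ω ^ 2 - sepPotential M a ω m Λ (ρ x)) atBot
      (𝓝 ((ω - m * horizonAngularVelocity M a) ^ 2)) := by
  have hM : 0 < M := hMa.pos
  have hr : 0 < rPlus M a := rPlus_pos hM a
  have hne : rPlus M a ^ 2 + a ^ 2 ≠ 0 := by positivity
  have hcont : ContinuousAt (sepPotential M a ω m Λ) (rPlus M a) :=
    (hasDerivAt_sepPotential M a ω m Λ hne).continuousAt
  have h := (tendsto_const_nhds (x := ω ^ 2)).sub (hcont.tendsto.comp hρ.tendsto_atBot)
  rwa [omega_sq_sub_sepPotential_rPlus_eq_sq (le_of_lt hMa) hM] at h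

/-! ### Sonin bounds on the horizon zone -/

section HorizonZone

variable {M a ω Λ : ℝ} {m : ℤ} {ρ : ℝ → ℝ} {u u₁ : ℝ → ℂ}

/-- **Sonin energy across the horizon zone, any solution**: for two points `x, y` with
`ρ x, ρ y ≤ r₊ + σ²M³/(416Λ)` (`σ = ω − mω₊ ≠ 0`), `T(y) ≤ 3^8 · T(x)` where `T = (ω² − V∘ρ)‖u‖² + ‖u′‖²`
(≤ 8 monotone pieces of the coefficient, ratio `φmax/φmin ≤ 3`). [folklore] -/
theorem carter_horizonZone_energy_le_of_data (hρ : IsTortoiseRadius M a ρ) (hMa : IsSubextremal M a)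
    (hadm : IsAdmissibleTriple a ω m Λ) (hΛ : 1 ≤ Λ) (hσ : ω - m * horizonAngularVelocity M a ≠ 0)
    (hu : ∀ x, HasDerivAt u (u₁ x) x ∧
      HasDerivAt u₁ (-(((ω ^ 2 - sepPotential M a ω m Λ (ρ x) : ℝ) : ℂ) * u x)) x)
    {x y : ℝ}
    (hx : ρ x - rPlus M a ≤ (ω - m * horizonAngularVelocity M a) ^ 2 * M ^ 3 / (416 * Λ))
    (hy : ρ y - rPlus M a ≤ (ω - m * horizonAngularVelocity M a) ^ 2 * M ^ 3 / (416 * Λ)) :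
    (ω ^ 2 - sepPotential M a ω m Λ (ρ y)) * ‖u y‖ ^ 2 + ‖u₁ y‖ ^ 2 ≤
      3 ^ 8 * ((ω ^ 2 - sepPotential M a ω m Λ (ρ x)) * ‖u x‖ ^ 2 + ‖u₁ x‖ ^ 2) := by
  set σ := ω - m * horizonAngularVelocity M a with hσdef
  set φ : ℝ → ℝ := fun s ↦ ω ^ 2 - sepPotential M a ω m Λ (ρ s) with hφ
  have hσ2 : 0 < σ ^ 2 := by positivity
  -- the two points span `[lo, hi]`, whose `ρ`-image lies in the horizon zone
  set lo := min x y with hlo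
  set hi := max x y with hhi
  have hzone_pt : ∀ s, s ≤ hi → σ ^ 2 / 2 ≤ φ s ∧ φ s ≤ 3 * σ ^ 2 / 2 := by
    intro s hs
    refine coeff_mem_Icc_of_horizonZone hρ hMa hadm hΛ ?_
    have hmono := (hρ.strictMono hMa).monotone hs
    rcases max_cases x y with ⟨e, _⟩ | ⟨e, _⟩
    · rw [hhi, e] at hmono; linarith
    · rw [hhi, e] at hmono; linarith
  have hTx : 0 ≤ φ x * ‖u x‖ ^ 2 + ‖u₁ x‖ ^ 2 := by
    have hφx : 0 ≤ φ x := le_trans (by positivity) (hzone_pt x (le_max_left _ _)).1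
    exact add_nonneg (mul_nonneg hφx (sq_nonneg _)) (sq_nonneg _)
  rcases eq_or_lt_of_le (min_le_max : lo ≤ hi) with heq | hlt
  · -- `x = y`
    have hxy : x = y := by
      have h1 : min x y = max x y := heq
      rcases le_total x y with h | h
      · rw [min_eq_left h, max_eq_right h] at h1; exact h1
      · rw [min_eq_right h, max_eq_left h] at h1; exact h1.symm
    subst hxy
    have h38 : (1 : ℝ) ≤ 3 ^ 8 := by norm_num
    have hTx' : 0 ≤ (ω ^ 2 - sepPotential M a ω m Λ (ρ x)) * ‖u x‖ ^ 2 + ‖u₁ x‖ ^ 2 := hTx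
    nlinarith
  obtain ⟨k, t, hk, ht0, htk, hmono_t, hmono⟩ := hρ.exists_monotone_partition hMa hadm hlt
  have hzone : ∀ s ∈ Icc (t 0) (t k), σ ^ 2 / 2 ≤ φ s ∧ φ s ≤ 3 * σ ^ 2 / 2 := by
    intro s hs
    rw [htk] at hs
    exact hzone_pt s hs.2
  have hxI : x ∈ Icc (t 0) (t k) := by rw [ht0, htk]; exact ⟨min_le_left _ _, le_max_left _ _⟩
  have hyI : y ∈ Icc (t 0) (t k) := by rw [ht0, htk]; exact ⟨min_le_right _ _, le_max_right _ _⟩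
  have key := Literature.Analysis.ODE.soninEnergy_le_pow_ratio (u := u) (u' := u₁) (φ := φ)
    (φ' := fun s ↦ -(deriv (sepPotential M a ω m Λ) (ρ s) * (delta M a (ρ s) / (ρ s ^ 2 + a ^ 2))))
    (φmin := σ ^ 2 / 2) (φmax := 3 * σ ^ 2 / 2) t hmono_t
    (fun s _ ↦ ⟨(hu s).1, by simpa only [hφ] using (hu s).2⟩)
    (fun s _ ↦ hρ.hasDerivAt_omega_sq_sub_sepPotential hMa ω m Λ s) hmono (by positivity) hzone hxI hyI
  have hratio : (3 * σ ^ 2 / 2) / (σ ^ 2 / 2) = 3 := by field_simp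
  rw [hratio] at key
  refine key.trans (mul_le_mul_of_nonneg_right (pow_le_pow_right₀ (by norm_num) hk) ?_)
  simpa only [hφ] using hTx

/-- **Sonin energy on the horizon zone, `𝓗⁺` data**: for a solution with `‖u‖ → 1`, `‖u′‖ → |ω − mω₊|`
at `−∞` (`σ = ω − mω₊ ≠ 0`) and every `y` with `ρ y − r₊ ≤ σ²M³/(416Λ)`:
`(ω² − V(ρ y))‖u y‖² + ‖u′ y‖² ≤ 3^9 σ²` (the limit of the energy at `−∞` is `2σ² < 3σ²`). [folklore] -/
theorem carter_horizonZone_energy_le (hρ : IsTortoiseRadius M a ρ) (hMa : IsSubextremal M a)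
    (hadm : IsAdmissibleTriple a ω m Λ) (hΛ : 1 ≤ Λ) (hσ : ω - m * horizonAngularVelocity M a ≠ 0)
    (hu : ∀ x, HasDerivAt u (u₁ x) x ∧
      HasDerivAt u₁ (-(((ω ^ 2 - sepPotential M a ω m Λ (ρ x) : ℝ) : ℂ) * u x)) x)
    (hlim : Tendsto (fun x ↦ ‖u x‖) atBot (𝓝 1))
    (hlim₁ : Tendsto (fun x ↦ ‖u₁ x‖) atBot (𝓝 |ω - m * horizonAngularVelocity M a|)) {y : ℝ}
    (hy : ρ y - rPlus M a ≤ (ω - m * horizonAngularVelocity M a) ^ 2 * M ^ 3 / (416 * Λ)) :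
    (ω ^ 2 - sepPotential M a ω m Λ (ρ y)) * ‖u y‖ ^ 2 + ‖u₁ y‖ ^ 2 ≤
      3 ^ 9 * (ω - m * horizonAngularVelocity M a) ^ 2 := by
  set σ := ω - m * horizonAngularVelocity M a with hσdef
  have hσ2 : 0 < σ ^ 2 := by positivity
  -- the energy tends to `2σ²` at `−∞`, hence is eventually `≤ 3σ²`
  have hT : Tendsto (fun x ↦ (ω ^ 2 - sepPotential M a ω m Λ (ρ x)) * ‖u x‖ ^ 2 + ‖u₁ x‖ ^ 2) atBot
      (𝓝 (2 * σ ^ 2)) := by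
    have h := ((hρ.tendsto_coeff_atBot hMa ω m Λ).mul (hlim.pow 2)).add (hlim₁.pow 2)
    have e : σ ^ 2 * 1 ^ 2 + |σ| ^ 2 = 2 * σ ^ 2 := by rw [one_pow, mul_one, sq_abs]; ring
    rw [e] at h
    exact h
  have hev : ∀ᶠ x in atBot, (ω ^ 2 - sepPotential M a ω m Λ (ρ x)) * ‖u x‖ ^ 2 + ‖u₁ x‖ ^ 2 ≤ 3 * σ ^ 2 :=
    (hT.eventually (eventually_le_nhds (by nlinarith : 2 * σ ^ 2 < 3 * σ ^ 2)))
  obtain ⟨x, hxT, hxy⟩ := (hev.and (eventually_le_atBot y)).exists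
  have hx : ρ x - rPlus M a ≤ σ ^ 2 * M ^ 3 / (416 * Λ) :=
    le_trans (by linarith [(hρ.strictMono hMa).monotone hxy]) hy
  have key := carter_horizonZone_energy_le_of_data hρ hMa hadm hΛ hσ hu hx hy
  calc _ ≤ 3 ^ 8 * ((ω ^ 2 - sepPotential M a ω m Λ (ρ x)) * ‖u x‖ ^ 2 + ‖u₁ x‖ ^ 2) := key
    _ ≤ 3 ^ 8 * (3 * σ ^ 2) := by gcongr
    _ = 3 ^ 9 * σ ^ 2 := by ring

/-- Consequences on the horizon zone (`𝓗⁺` data): `‖u y‖² ≤ 2·3^9` and `‖u′ y‖² ≤ 3^9 σ²`. [folklore] -/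
theorem carter_horizonZone_norm_sq_le (hρ : IsTortoiseRadius M a ρ) (hMa : IsSubextremal M a)
    (hadm : IsAdmissibleTriple a ω m Λ) (hΛ : 1 ≤ Λ) (hσ : ω - m * horizonAngularVelocity M a ≠ 0)
    (hu : ∀ x, HasDerivAt u (u₁ x) x ∧
      HasDerivAt u₁ (-(((ω ^ 2 - sepPotential M a ω m Λ (ρ x) : ℝ) : ℂ) * u x)) x)
    (hlim : Tendsto (fun x ↦ ‖u x‖) atBot (𝓝 1))
    (hlim₁ : Tendsto (fun x ↦ ‖u₁ x‖) atBot (𝓝 |ω - m * horizonAngularVelocity M a|)) {y : ℝ}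
    (hy : ρ y - rPlus M a ≤ (ω - m * horizonAngularVelocity M a) ^ 2 * M ^ 3 / (416 * Λ)) :
    ‖u y‖ ^ 2 ≤ 2 * 3 ^ 9 ∧ ‖u₁ y‖ ^ 2 ≤ 3 ^ 9 * (ω - m * horizonAngularVelocity M a) ^ 2 := by
  set σ := ω - m * horizonAngularVelocity M a with hσdef
  have hσ2 : 0 < σ ^ 2 := by positivity
  have hE := carter_horizonZone_energy_le hρ hMa hadm hΛ hσ hu hlim hlim₁ hy
  have hφ := (coeff_mem_Icc_of_horizonZone hρ hMa hadm hΛ hy).1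
  have hu2 : 0 ≤ ‖u₁ y‖ ^ 2 := sq_nonneg _
  have hf : 0 ≤ ‖u y‖ ^ 2 := sq_nonneg _
  constructor
  · -- `(σ²/2)‖u‖² ≤ 3^9 σ²`
    have h1 : σ ^ 2 / 2 * ‖u y‖ ^ 2 ≤ 3 ^ 9 * σ ^ 2 := by
      nlinarith [mul_le_mul_of_nonneg_right hφ hf]
    by_contra hcon
    push Not at hcon
    nlinarith
  · nlinarith [mul_nonneg (le_trans (by positivity) hφ) hf]

end HorizonZone

end Kerr

end Literature.Geometry.Lorentzian

end
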